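import Summits.BirchSwinnertonDyer.BirchSwinnertonDyer.Theorems.Rank2Observatory2DescUnitsModSq
import Literature.NumberTheory.NumberFields.SelmerGroupOddClass
import Mathlib.RingTheory.DedekindDomain.SelmerGroup
import Mathlib.LinearAlgebra.FreeModule.PID
import HarnessLib

/-!
# BirchSwinnertonDyer — rank ≥ 2 observatory: `T`-units modulo squares (KERNEL-2DESC-CL, N2)

HONEST FRAMING: per-curve certified theorems and census instruments; no claim on BSD in rank ≥ 2.

Generic file N2 of the class-group-general cubic-field `2`-descent (design
`b2b-bsdr2-cert-1/KERNEL-2DESC-CL.md`). `K` an odd-degree number field, `N ∈ 𝓞 K`, `T` a finite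
list of primes of `𝓞 K` containing every prime that contains `N`; the **`T`-units** are the
`u ∈ Kˣ` with `v(u) = 1` at every prime `v ∌ N`. They form a group `U_T ≅ (𝓞 K)ˣ × Λ_T` with
`Λ_T ⊆ ℤ^T` the lattice of valuation vectors, so `dim_{𝔽₂} U_T/U_T² ≤ rank K + 1 + #T`
(Dirichlet–Chevalley–Hasse `S`-unit theorem, the easy inequality). Consequently (the counting lemma
`TwoDescCubic.exists_isSquare_mul_prod_of_indep` of the PID instrument): **an explicit family of
`rank K + 1 + #T` `T`-units with no non-empty square sub-product spans the `T`-units modulo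
squares** — `exists_isSquare_tunit_mul_prod`. This is the hypothesis-free replacement, for cubic
fields of any class number, of the unit-family spanning `units_span` of the PID instrument; the
per-field / per-curve files supply the family (units, a basis of `Λ_{T_L}`, prime complements) and its
independence certificate.

## References
* D. A. Marcus, *Number Fields*, 2nd ed. (2018), Ch. 5 Thm. 38 (Dirichlet) and Ch. 6 (S-units).
  [Marcus2018]
* J. H. Silverman, *The Arithmetic of Elliptic Curves*, 2nd ed., GTM 106 (2009), Prop. VIII.1.6.
  [SilvermanAEC2009]
-/

-- single-conjunct summit: `Summit.BirchSwinnertonDyer.BirchSwinnertonDyer.…` repeats the name by design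
set_option linter.dupNamespace false

noncomputable section

open scoped Classical NumberField

namespace Summit.BirchSwinnertonDyer.BirchSwinnertonDyer.Rank2Observatory.TwoDescCl

open IsDedekindDomain IsDedekindDomain.HeightOneSpectrum NumberField NumberField.Units Module
open TwoDescCubic

variable {K : Type*} [Field K] [NumberField K]

/-- An element of `Kˣ` all of whose valuations are `1` is a unit of `𝓞 K`. [folklore] -/
theorem exists_unit_coe_eq_of_valuation_eq_one (x : Kˣ)
    (hx : ∀ v : HeightOneSpectrum (𝓞 K), v.valuation K (x : K) = 1) :
    ∃ u : (𝓞 K)ˣ, Units.map (algebraMap (𝓞 K) K : 𝓞 K →* K) u = x := by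
  obtain ⟨a, ha⟩ := mem_integers_of_valuation_le_one (R := 𝓞 K) K (x : K) (fun v => (hx v).le)
  obtain ⟨b, hb⟩ := mem_integers_of_valuation_le_one (R := 𝓞 K) K ((x⁻¹ : Kˣ) : K)
    (fun v => by rw [Units.val_inv_eq_inv_val, map_inv₀, hx v, inv_one])
  have hab : a * b = 1 := by
    apply IsFractionRing.injective (𝓞 K) K
    rw [map_mul, map_one]
    change (algebraMap (𝓞 K) K) a * (algebraMap (𝓞 K) K) b = 1
    rw [ha, hb, Units.val_inv_eq_inv_val, mul_inv_cancel₀ x.ne_zero]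
  refine ⟨⟨a, b, hab, by rw [mul_comm]; exact hab⟩, Units.ext ?_⟩
  simpa using ha

/-- Images of units of `𝓞 K` have all valuations `1`. [folklore] -/
theorem valuation_units_map_eq_one (u : (𝓞 K)ˣ) (v : HeightOneSpectrum (𝓞 K)) :
    v.valuation K ((Units.map (algebraMap (𝓞 K) K : 𝓞 K →* K) u : Kˣ) : K) = 1 := by
  have h := v.valuation_of_unit_eq (K := K) u
  rw [← WithZero.coe_inj, valuationOfNeZero_eq] at h
  exact_mod_cast h

/-- **`T`-units modulo squares** (odd-degree number field, any class number). Let `N ∈ 𝓞 K` and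
`T : Fin t → primes` list every prime containing `N`. If `W₀, …, W_{n-1}` (`n = rank K + 1 + t`) are
`T`-units (valuation `1` at every prime `∌ N`) with no non-empty square sub-product in `K`, then
every `T`-unit `u` satisfies `IsSquare (u · ∏_{i ∈ S} W i)` for some `S`: the family spans
`U_T / U_T²`. Proof: `U_T → ℤ^t` (valuations at `T`) has kernel the units and image a lattice
`Λ` with a `ℤ`-basis of `m ≤ t` vectors (`Submodule.basisOfPid`); lifting the basis to `σ₁ … σ_m ∈ U_T`,
every `T`-unit is `(sign-and-exponent unit representative) · ∏ σ_j^{0/1} · square`, i.e. `U_T/U_T²`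
has at most `2^{rank K + 1 + t}` elements, and the counting lemma
`exists_isSquare_mul_prod_of_indep` applies. [cite: Marcus2018, Ch. 5 Thm. 38]
[cite: SilvermanAEC2009, Prop. VIII.1.6 (proof)] -/
theorem exists_isSquare_tunit_mul_prod (hodd : Odd (finrank ℚ K)) (N : 𝓞 K) {t : ℕ}
    (T : Fin t → HeightOneSpectrum (𝓞 K))
    (hT : ∀ w : HeightOneSpectrum (𝓞 K), N ∈ w.asIdeal → ∃ i, T i = w)
    {n : ℕ} (hn : n = rank K + 1 + t) (W : Fin n → K) (hW0 : ∀ i, W i ≠ 0)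
    (hWT : ∀ i (v : HeightOneSpectrum (𝓞 K)), N ∉ v.asIdeal → v.valuation K (W i) = 1)
    (hind : ∀ S : Finset (Fin n), IsSquare (∏ i ∈ S, W i) → S = ∅)
    (u : K) (hu : u ≠ 0) (huT : ∀ v : HeightOneSpectrum (𝓞 K), N ∉ v.asIdeal → v.valuation K u = 1) :
    ∃ S : Finset (Fin n), IsSquare (u * ∏ i ∈ S, W i) := by
  -- the group of `T`-units
  let G : Subgroup Kˣ :=
    { carrier := {x | ∀ v : HeightOneSpectrum (𝓞 K), N ∉ v.asIdeal → v.valuation K (x : K) = 1}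
      one_mem' := fun v _ => by simp
      mul_mem' := fun {x y} hx hy v hv => by
        simp only [Set.mem_setOf_eq] at hx hy
        rw [Units.val_mul, map_mul, hx v hv, hy v hv, mul_one]
      inv_mem' := fun {x} hx v hv => by
        simp only [Set.mem_setOf_eq] at hx
        rw [Units.val_inv_eq_inv_val, map_inv₀, hx v hv, inv_one] }
  have hGmem : ∀ x : Kˣ, x ∈ G ↔ ∀ v : HeightOneSpectrum (𝓞 K), N ∉ v.asIdeal →
      v.valuation K (x : K) = 1 := fun x => Iff.rfl
  -- the valuation vector at `T`, additively
  let ψ : Additive Kˣ →+ (Fin t → ℤ) :=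
    { toFun := fun x i => Multiplicative.toAdd ((T i).valuationOfNeZero (Additive.toMul x))
      map_zero' := by ext i; simp
      map_add' := fun x y => by ext i; simp }
  have hψ : ∀ (x : Kˣ) (i : Fin t),
      ψ (Additive.ofMul x) i = Multiplicative.toAdd ((T i).valuationOfNeZero x) := fun x i => rfl
  -- the lattice `Λ = ψ(G)` and a `ℤ`-basis of it
  let Λ' : AddSubgroup (Fin t → ℤ) := AddSubgroup.map ψ (Subgroup.toAddSubgroup G)
  let Λ : Submodule ℤ (Fin t → ℤ) := AddSubgroup.toIntSubmodule Λ'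
  have hΛmem : ∀ y, y ∈ Λ ↔ ∃ x : Kˣ, x ∈ G ∧ ψ (Additive.ofMul x) = y := by
    intro y
    change y ∈ Λ' ↔ _
    simp only [Λ', AddSubgroup.mem_map]
    constructor
    · rintro ⟨z, hz, rfl⟩
      exact ⟨Additive.toMul z, by simpa using hz, rfl⟩
    · rintro ⟨x, hx, rfl⟩
      exact ⟨Additive.ofMul x, by simpa using hx, rfl⟩
  obtain ⟨m, bΛ⟩ := Submodule.basisOfPid (Pi.basisFun ℤ (Fin t)) Λ
  have hm : m ≤ t := by
    have hli : LinearIndependent ℤ (fun j => ((bΛ j : Λ) : Fin t → ℤ)) :=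
      bΛ.linearIndependent.map' Λ.subtype (Submodule.ker_subtype Λ)
    simpa using hli.fintype_card_le_finrank
  -- lift the basis to `T`-units `σ j`
  have hσex : ∀ j : Fin m, ∃ x : Kˣ, x ∈ G ∧ ψ (Additive.ofMul x) = (bΛ j : Fin t → ℤ) :=
    fun j => (hΛmem _).mp (bΛ j).2
  choose σ hσG hσψ using hσex
  -- every `T`-unit is `unit · ∏ σ^{a}`
  have hdecomp : ∀ x : Kˣ, x ∈ G → ∃ (a : Fin m → ℤ) (u₀ : (𝓞 K)ˣ),
      x = Units.map (algebraMap (𝓞 K) K : 𝓞 K →* K) u₀ * ∏ j, σ j ^ a j := by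
    intro x hx
    have hxΛ : ψ (Additive.ofMul x) ∈ Λ := (hΛmem _).mpr ⟨x, hx, rfl⟩
    let a : Fin m → ℤ := fun j => bΛ.repr ⟨_, hxΛ⟩ j
    have hsum : ∑ j, a j • (bΛ j : Fin t → ℤ) = ψ (Additive.ofMul x) := by
      have h := bΛ.sum_repr ⟨_, hxΛ⟩
      have h' := congrArg (fun z : Λ => (z : Fin t → ℤ)) h
      simpa only [Submodule.coe_sum, Submodule.coe_smul_of_tower] using h'
    let y : Kˣ := x * (∏ j, σ j ^ a j)⁻¹
    have hyG : y ∈ G := G.mul_mem hx (G.inv_mem (G.prod_mem fun j _ => G.zpow_mem (hσG j) _))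
    have hψy : ψ (Additive.ofMul y) = 0 := by
      have : Additive.ofMul y = Additive.ofMul x - ∑ j, a j • Additive.ofMul (σ j) := by
        simp only [y, ofMul_mul, ofMul_inv, ofMul_prod, ofMul_zpow, sub_eq_add_neg]
      rw [this, map_sub, map_sum]
      simp only [map_zsmul, hσψ]
      rw [hsum, sub_self]
    have hyval : ∀ v : HeightOneSpectrum (𝓞 K), v.valuation K (y : K) = 1 := by
      intro v
      by_cases hv : N ∈ v.asIdeal
      · obtain ⟨i, rfl⟩ := hT v hv
        have h := congrFun hψy i
        rw [hψ] at h
        simp only [Pi.zero_apply, toAdd_eq_zero] at h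
        rw [← valuationOfNeZero_eq, h]
        rfl
      · exact (hGmem y).mp hyG v hv
    obtain ⟨u₀, hu₀⟩ := exists_unit_coe_eq_of_valuation_eq_one y hyval
    refine ⟨a, u₀, ?_⟩
    rw [hu₀]
    simp [y]
  -- the representative system
  let κ := (Fin 2 × (Fin (rank K) → Fin 2)) × (Fin m → Fin 2)
  have hunitG : ∀ u₀ : (𝓞 K)ˣ, Units.map (algebraMap (𝓞 K) K : 𝓞 K →* K) u₀ ∈ G :=
    fun u₀ v _ => valuation_units_map_eq_one u₀ v
  let ρ : κ → G := fun kc =>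
    ⟨Units.map (algebraMap (𝓞 K) K : 𝓞 K →* K) (signFundRep kc.1) * ∏ j, σ j ^ ((kc.2 j : ℕ) : ℤ),
      G.mul_mem (hunitG _) (G.prod_mem fun j _ => G.zpow_mem (hσG j) _)⟩
  have hρ : ∀ x : G, ∃ kc : κ, ∃ η : G, x = ρ kc * η ^ 2 := by
    intro x
    obtain ⟨a, u₀, hx⟩ := hdecomp x x.2
    obtain ⟨k, η₀, hu₀⟩ := exists_sign_fundSystem_mul_sq hodd u₀
    let c : Fin m → Fin 2 := fun j => ⟨(a j % 2).toNat, by omega⟩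
    let d : Fin m → ℤ := fun j => a j / 2
    refine ⟨(k, c), ⟨Units.map (algebraMap (𝓞 K) K : 𝓞 K →* K) η₀ * ∏ j, σ j ^ d j,
      G.mul_mem (hunitG _) (G.prod_mem fun j _ => G.zpow_mem (hσG j) _)⟩, Subtype.ext ?_⟩
    have hsplit : ∀ j, σ j ^ a j = σ j ^ ((c j : ℕ) : ℤ) * (σ j ^ d j) ^ 2 := by
      intro j
      rw [← zpow_natCast (σ j ^ d j) 2, ← zpow_mul, ← zpow_add]
      congr 1
      simp only [c, d]
      push_cast
      rw [Int.toNat_of_nonneg (Int.emod_nonneg _ two_ne_zero)]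
      omega
    have hprod : (∏ j, σ j ^ a j) = (∏ j, σ j ^ ((c j : ℕ) : ℤ)) * (∏ j, σ j ^ d j) ^ 2 := by
      rw [← Finset.prod_pow, ← Finset.prod_mul_distrib]
      exact Finset.prod_congr rfl fun j _ => hsplit j
    change (x : Kˣ) = (Units.map (algebraMap (𝓞 K) K : 𝓞 K →* K) (signFundRep k) *
        ∏ j, σ j ^ ((c j : ℕ) : ℤ)) *
      (Units.map (algebraMap (𝓞 K) K : 𝓞 K →* K) η₀ * ∏ j, σ j ^ d j) ^ 2
    rw [hx, hu₀, hprod, map_mul, map_pow, mul_pow]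
    exact mul_mul_mul_comm _ _ _ _
  have hcard : Fintype.card κ ≤ 2 ^ Fintype.card (Fin n) := by
    simp only [κ, Fintype.card_prod, Fintype.card_fin, Fintype.card_fun, hn]
    calc 2 * 2 ^ rank K * 2 ^ m ≤ 2 * 2 ^ rank K * 2 ^ t :=
          Nat.mul_le_mul_left _ (Nat.pow_le_pow_right (by norm_num) hm)
      _ = 2 ^ (rank K + 1 + t) := by ring
  -- the family inside `G`
  let w : Fin n → G := fun i => ⟨Units.mk0 (W i) (hW0 i), fun v hv => by
    simpa only [Units.val_mk0] using hWT i v hv⟩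
  have hcoe : ∀ S : Finset (Fin n), (((∏ i ∈ S, w i : G) : Kˣ) : K) = ∏ i ∈ S, W i := by
    intro S
    rw [show ((∏ i ∈ S, w i : G) : Kˣ) = G.subtype (∏ i ∈ S, w i) from rfl, map_prod,
      Units.coe_prod]
    exact Finset.prod_congr rfl fun i _ => by simp [w]
  have hindG : ∀ S : Finset (Fin n), IsSquare (∏ i ∈ S, w i) → S = ∅ := by
    intro S ⟨r, hr⟩
    apply hind S
    refine ⟨((r : Kˣ) : K), ?_⟩
    have h := congrArg (fun z : G => ((z : Kˣ) : K)) hr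
    simpa only [hcoe, Subgroup.coe_mul, Units.val_mul] using h
  let x : G := ⟨Units.mk0 u hu, fun v hv => by simpa only [Units.val_mk0] using huT v hv⟩
  obtain ⟨S, r, hr⟩ := exists_isSquare_mul_prod_of_indep ρ hρ hcard w hindG x
  refine ⟨S, ((r : Kˣ) : K), ?_⟩
  have h := congrArg (fun z : G => ((z : Kˣ) : K)) hr
  simpa only [hcoe, Subgroup.coe_mul, Units.val_mul, x, Units.val_mk0] using h

end Summit.BirchSwinnertonDyer.BirchSwinnertonDyer.Rank2Observatory.TwoDescCl

end
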